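import Summits.QuantumFields.YangMills.Theorems.UnitScaleTiltProp7SectET3LandauRowsT3
import HarnessLib

/-!
# Route `UnitScaleTilt`, crux «MinimiserStabilityRegPr» (stmt-QuantumFields-19200, stub EX), node N06(d = 3), route (α) — LAYER 0, ROWS (def-free):
# **[Balaban1985Variational] (137)–(138) AT THE T³ MEMBER FOR THE LETTER OF RECORD `H46 = Hf … DeltaPiSlot`** — the two OPERATOR IDENTITIES behind print's
# second-order regularity of `H` («`D*DH`, `Δ_{U₀}H` are bounded in the norm `|·|₍₋₃₎`», p. 298): `Δ_π(Hω) = Q*((QGQ*)⁻¹ω) − Q*(a·ω)` ((137)) and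
# `Δ^η(Hω) = Δ_π(Hω) + (DG′R_SD*)†(Δ^η(Hω))` (the operator content of (138) «Δ′_πH simplifies essentially»), on the classes `PosOnto ∧ PosPrime`

Cell `ym3-torus`, width seat `ym3-torus-px5` (gen 0; FILL-TO-CAP «width 5»; (S)-sub-row `hΔH` of ★★OWNER ym3-torus-plan g27 RULING №7 (3), LOCATE memo
`HOME/ym3-torus-px5/LOCATE-HDH-137-140-px5.md` = stmt-QuantumFields-19200 evidence #56, steps (T1)+(T2-algebra)).  THEOREMS ONLY (0 `def`, 0 `sorry`);
`--supports stmt-QuantumFields-19200 --as helper`; count-neutral.  YM₃ on T³ is ladder rung R3, NOT the Clay problem; nothing here is a claim about a stub, a crux,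
d = 4 or the mass gap; nothing of [Balaban1985BackgroundPropagators] is asserted — finite-dimensional algebra on the displayed classes.

THE PRINT.  [Balaban1985Variational] p. 298 l.−4 – p. 299 l.3: *«Indeed, (3.126) [5] yields Δ_πH = (Δ_π + DRD* + Q*aQ)H − Q*a(L^{j(·)}η)⁻¹ = Q*(QGQ*)⁻¹(L^{j(·)}η)⁻¹ −
Q*a(L^{j(·)}η)⁻¹, (137) hence |Δ_πHB|₍₋₃₎ ≦ O(1)|B|. Above we have used the equality RD*H = 0. This equality implies also that Δ′_πH simplifies essentially, where
Δ_π = Δ − Δ′_π is defined by the formula (3.120) [5].»*  [Balaban1985BackgroundPropagators] (3.119) p. 419 *«⟨A, Δ_πA⟩ = ⟨A − DG′RD*A, Δ(A − DG′RD*A)⟩»*,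
(3.122) *«G = (Δ_π + DRD* + Q*aQ)⁻¹»*, (3.124) *«RD*GQ* = 0»*, (3.126) *«HB = GQ*(QGQ*)⁻¹B»* (p. 420).

THE LETTERS (layer 0, p01 lineage — all imported, nothing re-declared).  `Qk` (print's `Q_k` in A-units), `laplaceA … Δx U₀ = Δx + DR_SD* + Q*aQ` (3.26)∕(3.122), the class
`PosOnto … Δx U₀`, the total letters `GT`∕`KinvT`∕`HT` (brick L0d ✓`Prop7SectET3CurvedPropagators`); `DeltaEta` = print's `Δ^η(U₀)` (brick L0b ✓`Prop7SectET3WilsonHessian`);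
`GprimeT` = `G′` (3.25) on `PosPrime`, `gaugeCorr = 1 − DG′R_SD*`, `DeltaPi = (gaugeCorr)† ∘ Δ^η ∘ gaugeCorr` (3.119), `DeltaPiSlot`, `H46 = Hf … DeltaPiSlot` (✓`Prop7SectET3DeltaPi`);
the rows `laplaceA_apply`, `laplaceA_GT`, `Qk_HT`, `HT_eq_comp`, `RS_DstarL2_HT`, `inner_DL2_DeltaPi_eq_zero`, `inner_DeltaPi`, `gaugeCorr_apply`, `Hf_apply`.

WHAT IS PROVED (member `F`, `h : n ≤ K`, parameters `c₀ cB a`; `hp : PosOnto … (DeltaPiSlot …) U₀`, `hq : PosPrime … U₀`; ns `…Theorems.Prop7SectET3H137Rows`).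
* §1 ★ `laplaceA_HT_pi` — `Δ_a(Hω) = Q_k†((QGQ*)⁻¹ω)` (from `H = GQ†(QGQ*)⁻¹`, `Δ_aG = 1`); ★★★ `DeltaPi_HT` — **(137)**: `Δ_π(Hω) = Q_k†((QGQ*)⁻¹ω) − Q_k†(a·ω)`
  (the `DR_SD*` term dies by (3.124)₁∕(45)₂ `R_SD*H = 0`, the `Q*aQ` term reads `Q_kH = 1`).
* §2 ★ `gaugeCorr_HT` — `P(Hω) = Hω` («RD*H = 0» ⇒ the gauge correction of (3.119) fixes `Hω`); ★★★ `DeltaEta_HT` — **the operator content of (138)**: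
  `Δ^η(Hω) = Δ_π(Hω) + (DG′R_SD*)†(Δ^η(Hω))`, i.e. `Δ′_π(Hω) := Δ^η(Hω) − Δ_π(Hω)` IS the transpose of the gauge correction applied to `Δ^η(Hω)` — print's bracket
  (138) is this term paired with `A` ([Balaban1985Variational] (138) = ✓`B11Eq138Polarization.eq138_deltaPi_torus` as a FORM identity on the abstract lattice calculus);
  ★★ `DeltaEta_HT_eq` — both together: `Δ^η(Hω) = Q_k†((QGQ*)⁻¹ω) − Q_k†(a·ω) + (DG′R_SD*)†(Δ^η(Hω))`.
* §3 the same read on the ROUTE CARRIER `H46 … U₀ Y` (the `h46tw` letter of record, exponent scale `η`): ★ `toL2_H46` (`toL2 (H46 Y) = η • H(toL2B Y)`),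
  ★★ `DeltaPi_toL2_H46`, ★★ `DeltaEta_toL2_H46`.
HONEST SCOPE.  These are the two ALGEBRAIC steps of print's derivation of `|Δ_πHB|₍₋₃₎, |ΔHB|₍₋₃₎ ≤ O(1)|B|` ((137)–(139)); the BOUNDS (sup rows of `Q_k†`, `(QGQ*)⁻¹`, `G′`, the
`J`-bracket reading of `D*Δ^η`, (46)) are NOT here — they are the displayed N06-class inputs (I1)–(I5) of the LOCATE memo; (3.10)+(140)+(135) (the `D*D` ∕ `Δ_{U₀}` rows) are the
next file.  No positivity is proved (the classes are hypotheses); nothing continuum ∕ OS ∕ mass-gap ∕ Clay.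

References: T. Bałaban, CMP **102** (1985) 277–309 [Balaban1985Variational] ((45) p.285, (137)–(139) pp.298–299); CMP **99** (1985) 389–434 [Balaban1985BackgroundPropagators]
((3.26) p.395, (3.119)–(3.126) pp.419–420).
-/

set_option autoImplicit false

noncomputable section

open scoped InnerProductSpace ComplexConjugate Matrix.Norms.L2Operator

namespace Summit.QuantumFields.YangMills.Theorems.Prop7SectET3H137Rows

open Literature.MathematicalPhysics.QuantumFieldTheory.Balaban1983to89
open Literature.MathematicalPhysics.QuantumFieldTheory.Balaban1983to89.T3ContinuumYM3Torus
open T3SectALandauChart (eta)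
open B9SectCLatticeCarrier (Bond)
open B9Eq311L2Pairing (WL2)
open B11Eq103H1Complex (SiteL2K BondL2K)
open Summit.QuantumFields.YangMills.Theorems.Prop7SectET3Transport (periodsT3)
open Summit.QuantumFields.YangMills.Theorems.Prop7SectET3HilbertLetters (W₂ toL2 toL2B DL2 DstarL2)
open Summit.QuantumFields.YangMills.Theorems.Prop7SectET3GaugeProjector (RS)
open Summit.QuantumFields.YangMills.Theorems.Prop7SectET3WilsonHessian (DeltaEta)
open Summit.QuantumFields.YangMills.Theorems.Prop7SectET3CurvedPropagators
open Summit.QuantumFields.YangMills.Theorems.Prop7SectET3DeltaPi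

variable {F : T3Family} {n K : ℕ} {h : n ≤ K} {c₀ cB a : ℝ} [Fact (0 < c₀)] [Fact (0 < cB)]

/-! ## §1 (137): `Δ_π(Hω) = Q_k†((QGQ*)⁻¹ω) − Q_k†(a·ω)` -/

/-- ★ **`Δ_a(Hω) = Q_k†((QGQ*)⁻¹ω)` ON THE CLASS** — «(Δ_π + DRD* + Q*aQ)H = Q*(QGQ*)⁻¹» (from `H = GQ†(QGQ*)⁻¹` (3.126) and `Δ_aG = 1` (3.122)), for any Hessian letter `Δx`.
[cite: Balaban1985Variational, (137) p.298; Balaban1985BackgroundPropagators, (3.122) p.420, (3.126) p.420] -/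
theorem laplaceA_HT_pi
    {Δx : GaugeField (F.P K) 0 (Matrix.specialUnitaryGroup (Fin 2) ℂ) → (BondL2K ℂ 3 (periodsT3 F K) c₀ W₂ →ₗ[ℂ] BondL2K ℂ 3 (periodsT3 F K) c₀ W₂)}
    {U₀ : GaugeField (F.P K) 0 (Matrix.specialUnitaryGroup (Fin 2) ℂ)} (hp : PosOnto F n K h c₀ cB a Δx U₀)
    (ω : WL2 ℂ (fun _ : PBond (F.P n) 0 => cB) W₂) :
    laplaceA F n K h c₀ cB a Δx U₀ (HT F n K h c₀ cB a Δx U₀ ω)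
      = LinearMap.adjoint (Qk F n K h c₀ cB U₀) (KinvT F n K h c₀ cB a Δx U₀ ω) := by
  rw [HT_eq_comp hp, LinearMap.comp_apply, LinearMap.comp_apply, laplaceA_GT hp]

/-- ★★★ **(137) AT THE MEMBER: `Δ_π(Hω) = Q_k†((QGQ*)⁻¹ω) − Q_k†(a·ω)`** for print's `H = GQ*(QGQ*)⁻¹` at the Hessian letter `Δ_π` («Indeed, (3.126) [5] yields Δ_πH =
(Δ_π + DRD* + Q*aQ)H − Q*a … = Q*(QGQ*)⁻¹ … − Q*a …»; the `DR_SD*` term vanishes by «RD*H = 0» = (3.124)₁ on `PosOnto ∧ PosPrime`, the `Q*aQ` term reads `Q_kH = 1` = (45)).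
[cite: Balaban1985Variational, (137) p.298, (45) p.285; Balaban1985BackgroundPropagators, (3.124) p.420, (3.126) p.420] -/
theorem DeltaPi_HT {U₀ : GaugeField (F.P K) 0 (Matrix.specialUnitaryGroup (Fin 2) ℂ)}
    (hp : PosOnto F n K h c₀ cB a (DeltaPiSlot F n K h c₀ cB a) U₀) (hq : PosPrime F n K h c₀ cB a U₀)
    (ω : WL2 ℂ (fun _ : PBond (F.P n) 0 => cB) W₂) :
    DeltaPi F n K h c₀ cB a U₀ (HT F n K h c₀ cB a (DeltaPiSlot F n K h c₀ cB a) U₀ ω)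
      = LinearMap.adjoint (Qk F n K h c₀ cB U₀) (KinvT F n K h c₀ cB a (DeltaPiSlot F n K h c₀ cB a) U₀ ω)
        - LinearMap.adjoint (Qk F n K h c₀ cB U₀) (((a : ℂ)) • ω) := by
  -- `Δ_a(Hω) = Δ_π(Hω) + D(R_S(D*(Hω))) + Q†(a·Q(Hω))` with `R_SD*H = 0`, `QH = 1`, and `Δ_a(Hω) = Q†((QGQ*)⁻¹ω)`
  have hA := laplaceA_apply (Δx := DeltaPiSlot F n K h c₀ cB a) (h := h) (cB := cB) (a := a) U₀
    (HT F n K h c₀ cB a (DeltaPiSlot F n K h c₀ cB a) U₀ ω)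
  rw [laplaceA_HT_pi hp, RS_DstarL2_HT hp (inner_DL2_DeltaPi_eq_zero hq), map_zero, add_zero, Qk_HT hp,
    DeltaPiSlot_apply] at hA
  rw [hA, add_sub_cancel_right]

/-! ## §2 (138), operator content: `Δ^η(Hω) = Δ_π(Hω) + (DG′R_SD*)†(Δ^η(Hω))` -/

/-- ★ **`P(Hω) = Hω`**: the gauge correction `P = 1 − DG′R_SD*` of (3.119) FIXES `Hω` («Above we have used the equality RD*H = 0»).
[cite: Balaban1985Variational, p.299 l.1; Balaban1985BackgroundPropagators, (3.119) p.419, (3.124) p.420] -/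
theorem gaugeCorr_HT {U₀ : GaugeField (F.P K) 0 (Matrix.specialUnitaryGroup (Fin 2) ℂ)}
    (hp : PosOnto F n K h c₀ cB a (DeltaPiSlot F n K h c₀ cB a) U₀) (hq : PosPrime F n K h c₀ cB a U₀)
    (ω : WL2 ℂ (fun _ : PBond (F.P n) 0 => cB) W₂) :
    gaugeCorr F n K h c₀ cB a U₀ (HT F n K h c₀ cB a (DeltaPiSlot F n K h c₀ cB a) U₀ ω)
      = HT F n K h c₀ cB a (DeltaPiSlot F n K h c₀ cB a) U₀ ω := by
  rw [gaugeCorr_apply, RS_DstarL2_HT hp (inner_DL2_DeltaPi_eq_zero hq), map_zero, map_zero, sub_zero]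

/-- ★★★ **THE OPERATOR CONTENT OF (138): `Δ^η(Hω) = Δ_π(Hω) + (DG′R_SD*)†(Δ^η(Hω))`** — since `P(Hω) = Hω`, `Δ_π(Hω) = Pᵀ(Δ^η(Hω)) = Δ^η(Hω) − (DG′R_SD*)†(Δ^η(Hω))`:
the difference `Δ′_π(Hω) = Δ^η(Hω) − Δ_π(Hω)` («Δ′_πH simplifies essentially») is the transposed gauge correction of `Δ^η(Hω)`, whose pairing with `A` is print's bracket (138)
`⟨G′R_SD*A, D*Δ^η(HB)⟩`. [cite: Balaban1985Variational, (138) p.299; Balaban1985BackgroundPropagators, (3.119)–(3.120) p.419] -/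
theorem DeltaEta_HT {U₀ : GaugeField (F.P K) 0 (Matrix.specialUnitaryGroup (Fin 2) ℂ)}
    (hp : PosOnto F n K h c₀ cB a (DeltaPiSlot F n K h c₀ cB a) U₀) (hq : PosPrime F n K h c₀ cB a U₀)
    (ω : WL2 ℂ (fun _ : PBond (F.P n) 0 => cB) W₂) :
    DeltaEta F n K c₀ U₀ (HT F n K h c₀ cB a (DeltaPiSlot F n K h c₀ cB a) U₀ ω)
      = DeltaPi F n K h c₀ cB a U₀ (HT F n K h c₀ cB a (DeltaPiSlot F n K h c₀ cB a) U₀ ω)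
        + LinearMap.adjoint (DL2 F n K c₀ U₀ ∘ₗ GprimeT F n K h c₀ cB a U₀ ∘ₗ RS F n K h c₀ cB U₀ ∘ₗ DstarL2 F n K c₀ U₀)
            (DeltaEta F n K c₀ U₀ (HT F n K h c₀ cB a (DeltaPiSlot F n K h c₀ cB a) U₀ ω)) := by
  set X := HT F n K h c₀ cB a (DeltaPiSlot F n K h c₀ cB a) U₀ ω with hX
  refine ext_inner_left ℂ fun v => ?_
  -- `⟪v, Δ_π X⟫ = ⟪Pv, Δ^η(PX)⟫ = ⟪v − DG′R_SD*v, Δ^η X⟫ = ⟪v, Δ^η X⟫ − ⟪v, (DG′R_SD*)†(Δ^η X)⟫`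
  have hP : ⟪v, DeltaPi F n K h c₀ cB a U₀ X⟫_ℂ
      = ⟪v, DeltaEta F n K c₀ U₀ X⟫_ℂ
        - ⟪v, LinearMap.adjoint (DL2 F n K c₀ U₀ ∘ₗ GprimeT F n K h c₀ cB a U₀ ∘ₗ RS F n K h c₀ cB U₀ ∘ₗ DstarL2 F n K c₀ U₀)
            (DeltaEta F n K c₀ U₀ X)⟫_ℂ := by
    rw [inner_DeltaPi, hX, gaugeCorr_HT hp hq, ← hX, gaugeCorr_apply, inner_sub_left, LinearMap.adjoint_inner_right]
    rfl
  rw [inner_add_right, hP, sub_add_cancel]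

/-- ★★ **(137) AND (138) TOGETHER: `Δ^η(Hω) = Q_k†((QGQ*)⁻¹ω) − Q_k†(a·ω) + (DG′R_SD*)†(Δ^η(Hω))`** — `Δ^η H` is the sum of the two explicitly bounded coarse-lattice terms of (137)
and the transposed gauge correction of (138) («hence |ΔHB|₍₋₃₎ ≦ O(1)|B| (139)» once the sup rows are fed).
[cite: Balaban1985Variational, (137)–(139) pp.298–299] -/
theorem DeltaEta_HT_eq {U₀ : GaugeField (F.P K) 0 (Matrix.specialUnitaryGroup (Fin 2) ℂ)}
    (hp : PosOnto F n K h c₀ cB a (DeltaPiSlot F n K h c₀ cB a) U₀) (hq : PosPrime F n K h c₀ cB a U₀)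
    (ω : WL2 ℂ (fun _ : PBond (F.P n) 0 => cB) W₂) :
    DeltaEta F n K c₀ U₀ (HT F n K h c₀ cB a (DeltaPiSlot F n K h c₀ cB a) U₀ ω)
      = LinearMap.adjoint (Qk F n K h c₀ cB U₀) (KinvT F n K h c₀ cB a (DeltaPiSlot F n K h c₀ cB a) U₀ ω)
        - LinearMap.adjoint (Qk F n K h c₀ cB U₀) (((a : ℂ)) • ω)
        + LinearMap.adjoint (DL2 F n K c₀ U₀ ∘ₗ GprimeT F n K h c₀ cB a U₀ ∘ₗ RS F n K h c₀ cB U₀ ∘ₗ DstarL2 F n K c₀ U₀)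
            (DeltaEta F n K c₀ U₀ (HT F n K h c₀ cB a (DeltaPiSlot F n K h c₀ cB a) U₀ ω)) := by
  rw [← DeltaPi_HT hp hq ω]
  exact DeltaEta_HT hp hq ω

/-! ## §3 The same on the route carrier `H46 … U₀ Y` (the `h46tw` letter of record, exponent scale) -/

/-- ★ **`toL2 (H46 Y) = η • H(toL2B Y)`** — the `h46tw` letter read at the Hilbert level (`H_route = η·H_print`). [cite: Balaban1985Variational, (45)–(46) p.285] -/
theorem toL2_H46 (U₀ : GaugeField (F.P K) 0 (Matrix.specialUnitaryGroup (Fin 2) ℂ)) (Y : PBond (F.P n) 0 → Matrix (Fin 2) (Fin 2) ℂ) :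
    toL2 F K c₀ (H46 F n K h c₀ cB a U₀ Y)
      = (((eta F n K : ℝ) : ℂ)) • HT F n K h c₀ cB a (DeltaPiSlot F n K h c₀ cB a) U₀ (toL2B F n cB Y) := by
  rw [H46, Hf_apply, map_smul, LinearEquiv.apply_symm_apply]

/-- ★★ **(137) FOR THE ROUTE LETTER: `Δ_π(toL2 (H46 Y)) = η • (Q_k†((QGQ*)⁻¹(toL2B Y)) − Q_k†(a·toL2B Y))`.**
[cite: Balaban1985Variational, (137) p.298, (45) p.285] -/
theorem DeltaPi_toL2_H46 {U₀ : GaugeField (F.P K) 0 (Matrix.specialUnitaryGroup (Fin 2) ℂ)}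
    (hp : PosOnto F n K h c₀ cB a (DeltaPiSlot F n K h c₀ cB a) U₀) (hq : PosPrime F n K h c₀ cB a U₀)
    (Y : PBond (F.P n) 0 → Matrix (Fin 2) (Fin 2) ℂ) :
    DeltaPi F n K h c₀ cB a U₀ (toL2 F K c₀ (H46 F n K h c₀ cB a U₀ Y))
      = (((eta F n K : ℝ) : ℂ)) •
          (LinearMap.adjoint (Qk F n K h c₀ cB U₀) (KinvT F n K h c₀ cB a (DeltaPiSlot F n K h c₀ cB a) U₀ (toL2B F n cB Y))
            - LinearMap.adjoint (Qk F n K h c₀ cB U₀) (((a : ℂ)) • toL2B F n cB Y)) := by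
  rw [toL2_H46, map_smul, DeltaPi_HT hp hq]

/-- ★★ **(137)+(138) FOR THE ROUTE LETTER: `Δ^η(toL2 (H46 Y)) = η • (Q_k†((QGQ*)⁻¹Ỹ) − Q_k†(a·Ỹ)) + (DG′R_SD*)†(Δ^η(toL2 (H46 Y)))`, `Ỹ = toL2B Y`.**
[cite: Balaban1985Variational, (137)–(139) pp.298–299, (45) p.285] -/
theorem DeltaEta_toL2_H46 {U₀ : GaugeField (F.P K) 0 (Matrix.specialUnitaryGroup (Fin 2) ℂ)}
    (hp : PosOnto F n K h c₀ cB a (DeltaPiSlot F n K h c₀ cB a) U₀) (hq : PosPrime F n K h c₀ cB a U₀)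
    (Y : PBond (F.P n) 0 → Matrix (Fin 2) (Fin 2) ℂ) :
    DeltaEta F n K c₀ U₀ (toL2 F K c₀ (H46 F n K h c₀ cB a U₀ Y))
      = (((eta F n K : ℝ) : ℂ)) •
          (LinearMap.adjoint (Qk F n K h c₀ cB U₀) (KinvT F n K h c₀ cB a (DeltaPiSlot F n K h c₀ cB a) U₀ (toL2B F n cB Y))
            - LinearMap.adjoint (Qk F n K h c₀ cB U₀) (((a : ℂ)) • toL2B F n cB Y))
        + LinearMap.adjoint (DL2 F n K c₀ U₀ ∘ₗ GprimeT F n K h c₀ cB a U₀ ∘ₗ RS F n K h c₀ cB U₀ ∘ₗ DstarL2 F n K c₀ U₀)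
            (DeltaEta F n K c₀ U₀ (toL2 F K c₀ (H46 F n K h c₀ cB a U₀ Y))) := by
  rw [toL2_H46, map_smul,
    LinearMap.map_smul (LinearMap.adjoint
      (DL2 F n K c₀ U₀ ∘ₗ GprimeT F n K h c₀ cB a U₀ ∘ₗ RS F n K h c₀ cB U₀ ∘ₗ DstarL2 F n K c₀ U₀)),
    ← smul_add]
  congr 1
  exact DeltaEta_HT_eq hp hq _

end Summit.QuantumFields.YangMills.Theorems.Prop7SectET3H137Rows

end
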